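import Literature.NumberTheory.NumberFields.PositiveInvolutionCM
import HarnessLib

/-!
# A positive involution carrying `π` to `c π⁻¹` exists on `ℚ(π)` iff `|φ(π)|² = c` under every complex
# embedding (Kottwitz 1992, Lemma 10.1)

Topic `NumberTheory/NumberFields`, namespace `Literature.NumberTheory.NumberFields.PositiveInvolutionCNumber`
(lane `lit-hodgefound`, Track 2 foundations; seat `lit-hodgefound-p11`, generation 32, row g32-#6).  THEOREMS ONLY
(D-0026): no definition, no named fact, no instance, no notation.  Built on the tree's
`NumberFields/PositiveInvolution` (Shimura 1998 §5.1 Lemma 2: an endomorphism `ρ` of a number field with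
`0 ≤ Tr_{K/ℚ}(x · ρ x)` is complex conjugation under every embedding,
`comp_eq_conjugate_of_trace_mul_nonneg` / `apply_eq_conj_of_trace_mul_nonneg`, used BY NAME).

## The print, verbatim

R. E. Kottwitz, *Points on some Shimura varieties over finite fields*, J. Amer. Math. Soc. **5** (1992) [Kottwitz1992],
§10 p. 404 (held text `paper:doi-10-2307-2152772` p0032 L35–L48):

«**Lemma 10.1.** Let `c` be a positive rational number and let `π ∈ ℚ̄^×`. Then the following two conditions are
equivalent.  (1) There exists a positive involution on `ℚ[π]` carrying `π` into `c π⁻¹`.  (2) For every embedding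
of `ℚ[π]` in `ℂ` the image of `π` has absolute value `c^{1/2}`.

Tensor `ℚ[π]` with `ℝ` and decompose it as a product of copies of `ℝ` and `ℂ`. For both `ℝ` and `ℂ` the only
positive involution is `x ↦ x̄`. Therefore there is exactly one positive involution `ι` on `ℚ[π] ⊗_ℚ ℝ`, namely,
the one that induces `x ↦ x̄` on every copy of `ℝ` and `ℂ`. The first condition holds if and only if
`ι(π) = c π⁻¹` (since `ι(π) = c π⁻¹` implies that `ι(ℚ[π]) = ℚ[π]`), which holds if and only if `π̄ = c π⁻¹`
for every embedding of `ℚ[π]` in `ℂ`, or, in other words, if and only if the second condition holds.»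

(Lemma 10.3, (2) ⟺ (3), p. 405: «proved exactly the same way as Lemma 10.1» for the semisimple commutative
`ℚ`-algebra `ℚ[π_A] ⊆ End(A)`; Corollary 10.5: «`c` can be recovered by embedding `ℚ[π]` in `ℂ` and taking the
square of the absolute value of `π`».)

## What is formalised (the case where `ℚ[π]` is a FIELD: `K` a number field with `ℚ(π) = K`)

"Positive involution" = a ring endomorphism `ρ` of `K` with `0 < Tr_{K/ℚ}(x · ρ x)` for `x ≠ 0` (as in the tree's
`PositiveInvolution.lean` and Shimura's Lemma 2; that `ρ² = 1` is then automatic is the tree's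
`apply_apply_of_trace_mul_nonneg`).  "Absolute value `c^{1/2}`" is written `φ(π) · conj φ(π) = c`, equivalently
`‖φ π‖² = c`.

* §1 (1) ⇒ (2), for ANY number field containing `π`: **`mul_conj_embedding_eq_of_trace_mul_nonneg`**
  (`ρ` with non-negative trace form and `ρ(π) · π = c` ⇒ `φ(π) conj φ(π) = c` for every `φ : K → ℂ`),
  `norm_embedding_sq_eq_of_trace_mul_nonneg` (`‖φ π‖² = c`); Corollary 10.5 `eq_of_trace_mul_nonneg_of_mul_eq`
  (`c` is determined by `π`); «exactly one positive involution»: **`eq_of_trace_mul_nonneg`** (two endomorphisms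
  with non-negative trace forms coincide).
* §2 (2) ⇒ (1) for `K = ℚ(π)`: `aeval_div_minpoly_eq_zero` (`c/π` is a root of the minimal polynomial of `π`),
  **`exists_algHom_apply_eq_div`** (an endomorphism `ρ` of `K = ℚ(π)` with `ρ π = c/π`),
  `apply_comp_eq_conj` (`φ ∘ ρ = conj ∘ φ` for such `ρ`), `trace_mul_pos_of_forall_apply_eq_conj` (the trace form
  of an endomorphism that is complex conjugation under every embedding is positive definite), and
  **`exists_positiveInvolution_of_mul_conj_embedding_eq`** (Lemma 10.1 (2) ⇒ (1): a positive involution `ρ`,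
  `ρ² = 1`, with `ρ(π) · π = c`).
* §3 **`exists_positiveInvolution_iff`** — Lemma 10.1 as printed, for `K = ℚ(π)`.
* §4 (rider) the dichotomy behind «decompose it as a product of copies of `ℝ` and `ℂ`»:
  **`isTotallyReal_or_isCMField_of_norm_embedding_sq_eq`** (`K = ℚ(π)` with `|φ(π)|² = c` is totally real or CM —
  via the tree's `isTotallyReal_or_isCMField_of_trace_mul_nonneg`), `sq_eq_of_isTotallyReal` (totally real:
  `π² = c`), **`complexConj_mul_self_eq_iff`** (CM field, no generation hypothesis: `π̄ π = c ⟺ |φ(π)|² = c` for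
  all `φ` — Lemma 10.1 with the positive involution = complex conjugation).

`-- TODO(general form):` `ℚ[π]` a reduced (semisimple) commutative `ℚ`-algebra = a finite product of number
fields — the lemma is applied factorwise; not needed by the lane yet.

## References

* [Kottwitz1992] §10 Lemma 10.1 p. 404; Lemma 10.3, Corollary 10.5 p. 405.
* [Shimura1998] G. Shimura, *Abelian Varieties with Complex Multiplication and Modular Functions* (1998), §5.1
  Lemma 2 p. 36 (the tree's `PositiveInvolution.lean`).
-/

namespace Literature.NumberTheory.NumberFields.PositiveInvolutionCNumber

open NumberField NumberField.ComplexEmbedding Polynomial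
open scoped ComplexConjugate IntermediateField

variable {K : Type*} [Field K] [NumberField K]

/-! ## §1 (1) ⇒ (2): a positive involution with `ρ(π) π = c` forces `|φ(π)|² = c` -/

/-- **Lemma 10.1, (1) ⇒ (2).**  If `ρ` is an endomorphism of the number field `K` with non-negative trace form
(`0 ≤ Tr_{K/ℚ}(x · ρ x)`; e.g. a positive involution) and `ρ(π) · π = c`, then `φ(π) · conj φ(π) = c` for every
complex embedding `φ` — `ρ` is complex conjugation under `φ` (Shimura's Lemma 2, the tree's
`apply_eq_conj_of_trace_mul_nonneg`). [cite: Kottwitz1992, §10 Lemma 10.1 p. 404] -/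
theorem mul_conj_embedding_eq_of_trace_mul_nonneg (ρ : K →+* K)
    (hρ : ∀ x : K, 0 ≤ Algebra.trace ℚ K (x * ρ x)) {π : K} {c : ℚ} (hπ : ρ π * π = c) (φ : K →+* ℂ) :
    φ π * conj (φ π) = c := by
  rw [← apply_eq_conj_of_trace_mul_nonneg ρ hρ φ π, ← map_mul, mul_comm, hπ, map_ratCast]

/-- The same in the printed form «the image of `π` has absolute value `c^{1/2}`»: `‖φ π‖² = c`.
[cite: Kottwitz1992, §10 Lemma 10.1 p. 404] -/
theorem norm_embedding_sq_eq_of_trace_mul_nonneg (ρ : K →+* K)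
    (hρ : ∀ x : K, 0 ≤ Algebra.trace ℚ K (x * ρ x)) {π : K} {c : ℚ} (hπ : ρ π * π = c) (φ : K →+* ℂ) :
    ‖φ π‖ ^ 2 = c := by
  have h := mul_conj_embedding_eq_of_trace_mul_nonneg ρ hρ hπ φ
  rw [Complex.mul_conj, Complex.normSq_eq_norm_sq] at h
  exact_mod_cast h

/-- **Corollary 10.5 («`c` can be recovered by embedding `ℚ[π]` in `ℂ` and taking the square of the absolute value
of `π`»)**: if endomorphisms with non-negative trace forms carry `π` to `c π⁻¹` and to `c' π⁻¹`, then `c = c'`.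
[cite: Kottwitz1992, §10 Corollary 10.5 p. 405] -/
theorem eq_of_trace_mul_nonneg_of_mul_eq (ρ ρ' : K →+* K) (hρ : ∀ x : K, 0 ≤ Algebra.trace ℚ K (x * ρ x))
    (hρ' : ∀ x : K, 0 ≤ Algebra.trace ℚ K (x * ρ' x)) {π : K} {c c' : ℚ} (hπ : ρ π * π = c)
    (hπ' : ρ' π * π = c') : c = c' := by
  let φ : K →+* ℂ := Classical.choice inferInstance
  have h := (mul_conj_embedding_eq_of_trace_mul_nonneg ρ hρ hπ φ).symm.trans
    (mul_conj_embedding_eq_of_trace_mul_nonneg ρ' hρ' hπ' φ)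
  exact_mod_cast h

/-- **«There is exactly one positive involution»**: two endomorphisms of a number field whose trace forms are
non-negative coincide (both are complex conjugation under any embedding, which is injective).
[cite: Kottwitz1992, §10 Lemma 10.1 p. 404 (proof)] -/
theorem eq_of_trace_mul_nonneg (ρ ρ' : K →+* K) (hρ : ∀ x : K, 0 ≤ Algebra.trace ℚ K (x * ρ x))
    (hρ' : ∀ x : K, 0 ≤ Algebra.trace ℚ K (x * ρ' x)) : ρ = ρ' := by
  let φ : K →+* ℂ := Classical.choice inferInstance
  refine RingHom.ext fun x => φ.injective ?_
  rw [apply_eq_conj_of_trace_mul_nonneg ρ hρ φ x, apply_eq_conj_of_trace_mul_nonneg ρ' hρ' φ x]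

/-! ## §2 (2) ⇒ (1) for `K = ℚ(π)` -/

omit [NumberField K] in
/-- Under (2), `π ≠ 0` and `conj φ(π) = φ(c/π)`. [folklore] -/
private theorem conj_embedding_eq_embedding_div {π : K} {c : ℚ} (hc : 0 < c)
    (h : ∀ φ : K →+* ℂ, φ π * conj (φ π) = c) (φ : K →+* ℂ) : conj (φ π) = φ ((c : K) / π) := by
  have hφπ : φ π ≠ 0 := by
    intro h0
    have := h φ
    rw [h0, zero_mul] at this
    exact (ne_of_gt hc) (by exact_mod_cast this.symm)
  rw [map_div₀, map_ratCast, eq_div_iff hφπ, mul_comm, h φ]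

/-- **`c/π` is a root of the minimal polynomial of `π`** under (2): for any embedding `φ`,
`φ(c/π) = conj φ(π)` is the image of `π` under the embedding `conj ∘ φ`, hence a root of `minpoly_ℚ(π)`; pull
back along the injective `φ`. [cite: Kottwitz1992, §10 Lemma 10.1 p. 404] -/
theorem aeval_div_minpoly_eq_zero {π : K} {c : ℚ} (hc : 0 < c) (h : ∀ φ : K →+* ℂ, φ π * conj (φ π) = c) :
    aeval ((c : K) / π) (minpoly ℚ π) = 0 := by
  let φ : K →+* ℂ := Classical.choice inferInstance
  apply φ.injective
  have h1 : φ (aeval ((c : K) / π) (minpoly ℚ π)) = aeval (φ ((c : K) / π)) (minpoly ℚ π) := by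
    have h0 := Polynomial.aeval_algHom_apply φ.toRatAlgHom ((c : K) / π) (minpoly ℚ π)
    simpa only [RingHom.toRatAlgHom_apply] using h0.symm
  have h2 : aeval (conj (φ π)) (minpoly ℚ π) = conj (aeval (φ π) (minpoly ℚ π)) := by
    have h0 := Polynomial.aeval_algHom_apply (starRingEnd ℂ).toRatAlgHom (φ π) (minpoly ℚ π)
    simpa only [RingHom.toRatAlgHom_apply] using h0
  have h3 : aeval (φ π) (minpoly ℚ π) = 0 := by
    have h0 := Polynomial.aeval_algHom_apply φ.toRatAlgHom π (minpoly ℚ π)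
    rw [RingHom.toRatAlgHom_apply, minpoly.aeval, map_zero] at h0
    exact h0
  rw [map_zero, h1, ← conj_embedding_eq_embedding_div hc h φ, h2, h3, map_zero]

/-- **An endomorphism of `K = ℚ(π)` carrying `π` to `c/π`** exists under (2) (lift along the power basis of
`ℚ(π)`: `c/π` is a root of `minpoly_ℚ(π)`). [cite: Kottwitz1992, §10 Lemma 10.1 p. 404] -/
theorem exists_algHom_apply_eq_div {π : K} (hgen : ℚ⟮π⟯ = ⊤) {c : ℚ} (hc : 0 < c)
    (h : ∀ φ : K →+* ℂ, φ π * conj (φ π) = c) : ∃ ρ : K →ₐ[ℚ] K, ρ π = (c : K) / π := by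
  have hint : IsIntegral ℚ π := Algebra.IsIntegral.isIntegral π
  have hroot : (c : K) / π ∈ (minpoly ℚ π).aroots K := by
    rw [mem_aroots]
    exact ⟨minpoly.ne_zero hint, aeval_div_minpoly_eq_zero hc h⟩
  let ψ : ℚ⟮π⟯ →ₐ[ℚ] K := (IntermediateField.algHomAdjoinIntegralEquiv ℚ hint).symm ⟨(c : K) / π, hroot⟩
  have hψ : ψ (IntermediateField.AdjoinSimple.gen ℚ π) = (c : K) / π :=
    IntermediateField.algHomAdjoinIntegralEquiv_symm_apply_gen ℚ hint ⟨(c : K) / π, hroot⟩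
  let e : K ≃ₐ[ℚ] ℚ⟮π⟯ := (IntermediateField.topEquiv.symm.trans (IntermediateField.equivOfEq hgen.symm))
  refine ⟨ψ.comp (e : K →ₐ[ℚ] ℚ⟮π⟯), ?_⟩
  have he : e π = IntermediateField.AdjoinSimple.gen ℚ π := by
    apply Subtype.ext
    rfl
  rw [AlgHom.comp_apply, AlgEquiv.coe_toAlgHom, he, hψ]

/-- For an endomorphism `ρ` of `K = ℚ(π)` with `ρ π = c/π`, under (2): `φ ∘ ρ = conj ∘ φ` for every embedding
(the two ring homomorphisms agree on the generator `π`). [cite: Kottwitz1992, §10 Lemma 10.1 p. 404] -/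
theorem apply_comp_eq_conj {π : K} (hgen : ℚ⟮π⟯ = ⊤) {c : ℚ} (hc : 0 < c)
    (h : ∀ φ : K →+* ℂ, φ π * conj (φ π) = c) (ρ : K →ₐ[ℚ] K) (hρ : ρ π = (c : K) / π) (φ : K →+* ℂ)
    (x : K) : φ (ρ x) = conj (φ x) := by
  have hint : IsIntegral ℚ π := Algebra.IsIntegral.isIntegral π
  have htop : Algebra.adjoin ℚ {π} = ⊤ :=
    (IntermediateField.adjoin_simple_eq_top_iff_of_isAlgebraic hint.isAlgebraic).mp hgen
  have key : (φ.toRatAlgHom).comp ρ = ((starRingEnd ℂ).toRatAlgHom).comp φ.toRatAlgHom := by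
    refine AlgHom.ext_of_adjoin_eq_top htop fun y hy => ?_
    rw [Set.mem_singleton_iff] at hy
    subst hy
    rw [AlgHom.comp_apply, AlgHom.comp_apply, RingHom.toRatAlgHom_apply, RingHom.toRatAlgHom_apply,
      RingHom.toRatAlgHom_apply, hρ, ← conj_embedding_eq_embedding_div hc h φ]
  have := congrArg (fun f : K →ₐ[ℚ] ℂ => f x) key
  simpa only [AlgHom.comp_apply, RingHom.toRatAlgHom_apply] using this

/-- `Tr_{K/ℚ}(y) = Σ_φ φ(y)` in `ℂ` over the ring embeddings. [folklore] -/
private theorem algebraMap_trace_eq_sum_ringHom (y : K) :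
    ((Algebra.trace ℚ K y : ℚ) : ℂ) = ∑ φ : K →+* ℂ, φ y := by
  have h := trace_eq_sum_embeddings ℂ (K := ℚ) (L := K) (x := y)
  rw [eq_ratCast] at h
  rw [h]
  exact Fintype.sum_equiv (RingHom.equivRatAlgHom).symm _ _ fun σ => rfl

/-- **An endomorphism that is complex conjugation under every embedding has positive definite trace form**:
`Tr_{K/ℚ}(x · ρ x) = Σ_φ |φ x|² > 0` for `x ≠ 0` (the converse half of Shimura's Lemma 2, as used by Kottwitz:
«the one that induces `x ↦ x̄` on every copy of `ℝ` and `ℂ`» is positive). [cite: Kottwitz1992, §10 Lemma 10.1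
p. 404 (proof)] -/
theorem trace_mul_pos_of_forall_apply_eq_conj (ρ : K →+* K) (hρ : ∀ (φ : K →+* ℂ) (x : K), φ (ρ x) = conj (φ x))
    {x : K} (hx : x ≠ 0) : 0 < Algebra.trace ℚ K (x * ρ x) := by
  classical
  set t : ℚ := Algebra.trace ℚ K (x * ρ x) with ht
  have key : ((t : ℚ) : ℂ) = ((∑ φ : K →+* ℂ, Complex.normSq (φ x) : ℝ) : ℂ) := by
    rw [ht, algebraMap_trace_eq_sum_ringHom]
    push_cast
    refine Finset.sum_congr rfl fun φ _ => ?_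
    rw [map_mul, hρ φ x, Complex.mul_conj]
  have hpos : 0 < ∑ φ : K →+* ℂ, Complex.normSq (φ x) := by
    have hne : (Finset.univ : Finset (K →+* ℂ)).Nonempty := ⟨Classical.choice inferInstance, Finset.mem_univ _⟩
    refine Finset.sum_pos (fun φ _ => Complex.normSq_pos.mpr ?_) hne
    exact fun h0 => hx (φ.injective (by rw [h0, map_zero]))
  have hq : ((t : ℚ) : ℝ) = ∑ φ : K →+* ℂ, Complex.normSq (φ x) := by
    have h1 : (((t : ℚ) : ℝ) : ℂ) = ((t : ℚ) : ℂ) := by norm_cast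
    exact_mod_cast h1.trans key
  exact_mod_cast (hq ▸ hpos : (0 : ℝ) < ((t : ℚ) : ℝ))

/-- **Lemma 10.1, (2) ⇒ (1)** for `K = ℚ(π)`: if `|φ(π)|² = c` (`φ(π) conj φ(π) = c`) for every complex embedding
`φ`, with `c > 0`, then `K` carries a positive involution `ρ` (`0 < Tr(x · ρ x)` for `x ≠ 0`, `ρ² = 1`) with
`ρ(π) · π = c`, i.e. «carrying `π` into `c π⁻¹`». [cite: Kottwitz1992, §10 Lemma 10.1 p. 404] -/
theorem exists_positiveInvolution_of_mul_conj_embedding_eq {π : K} (hgen : ℚ⟮π⟯ = ⊤) {c : ℚ} (hc : 0 < c)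
    (h : ∀ φ : K →+* ℂ, φ π * conj (φ π) = c) :
    ∃ ρ : K →+* K, (∀ x : K, x ≠ 0 → 0 < Algebra.trace ℚ K (x * ρ x)) ∧ (∀ x, ρ (ρ x) = x) ∧
      ρ π * π = c := by
  obtain ⟨ρ, hρ⟩ := exists_algHom_apply_eq_div hgen hc h
  have hconj : ∀ (φ : K →+* ℂ) (x : K), φ ((ρ : K →+* K) x) = conj (φ x) :=
    fun φ x => apply_comp_eq_conj hgen hc h ρ hρ φ x
  have hpos : ∀ x : K, x ≠ 0 → 0 < Algebra.trace ℚ K (x * (ρ : K →+* K) x) :=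
    fun x hx => trace_mul_pos_of_forall_apply_eq_conj (ρ : K →+* K) hconj hx
  have hnonneg : ∀ x : K, 0 ≤ Algebra.trace ℚ K (x * (ρ : K →+* K) x) := by
    intro x
    by_cases hx : x = 0
    · rw [hx, zero_mul, map_zero]
    · exact (hpos x hx).le
  have hπ0 : π ≠ 0 := by
    intro h0
    let φ : K →+* ℂ := Classical.choice inferInstance
    have := h φ
    rw [h0, map_zero, zero_mul] at this
    exact (ne_of_gt hc) (by exact_mod_cast this.symm)
  refine ⟨ρ, hpos, apply_apply_of_trace_mul_nonneg _ hnonneg, ?_⟩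
  rw [AlgHom.coe_toRingHom, hρ, div_mul_cancel₀ _ hπ0]

/-! ## §3 Lemma 10.1 as an equivalence -/

/-- **Kottwitz's Lemma 10.1** (the case `ℚ[π] = ℚ(π)` a number field `K`; `c > 0` rational): «(1) There exists a
positive involution on `ℚ[π]` carrying `π` into `c π⁻¹`» ⟺ «(2) for every embedding of `ℚ[π]` in `ℂ` the image of
`π` has absolute value `c^{1/2}`».  A positive involution is an endomorphism with `0 < Tr(x · ρ x)` for `x ≠ 0`
(involutivity follows). [cite: Kottwitz1992, §10 Lemma 10.1 p. 404] -/
theorem exists_positiveInvolution_iff {π : K} (hgen : ℚ⟮π⟯ = ⊤) {c : ℚ} (hc : 0 < c) :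
    (∃ ρ : K →+* K, (∀ x : K, x ≠ 0 → 0 < Algebra.trace ℚ K (x * ρ x)) ∧ ρ π * π = c) ↔
      ∀ φ : K →+* ℂ, ‖φ π‖ ^ 2 = c := by
  constructor
  · rintro ⟨ρ, hρ, hπ⟩ φ
    refine norm_embedding_sq_eq_of_trace_mul_nonneg ρ (fun x => ?_) hπ φ
    by_cases hx : x = 0
    · rw [hx, zero_mul, map_zero]
    · exact (hρ x hx).le
  · intro h
    have h' : ∀ φ : K →+* ℂ, φ π * conj (φ π) = c := fun φ => by
      rw [Complex.mul_conj, Complex.normSq_eq_norm_sq]; exact_mod_cast h φ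
    obtain ⟨ρ, hρ, -, hπ⟩ := exists_positiveInvolution_of_mul_conj_embedding_eq hgen hc h'
    exact ⟨ρ, hρ, hπ⟩

/-! ## §4 The dichotomy: `ℚ(π)` is totally real (`π² = c`) or a CM field (`π̄ π = c`) -/

/-- Strict positivity off `0` gives the non-negative trace form used by the tree's Lemma 2 files. [folklore] -/
private theorem trace_mul_nonneg_of_pos (ρ : K →+* K) (hρ : ∀ x : K, x ≠ 0 → 0 < Algebra.trace ℚ K (x * ρ x))
    (x : K) : 0 ≤ Algebra.trace ℚ K (x * ρ x) := by
  by_cases hx : x = 0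
  · rw [hx, zero_mul, map_zero]
  · exact (hρ x hx).le

/-- **`ℚ(π)` is totally real or CM when `|φ(π)|² = c` for every embedding** (`c > 0`): the positive involution of
Lemma 10.1 makes Shimura's dichotomy (the tree's `isTotallyReal_or_isCMField_of_trace_mul_nonneg`) apply — «decompose
`ℚ[π] ⊗ ℝ` as a product of copies of `ℝ` and `ℂ` … the only positive involution is `x ↦ x̄`».
[cite: Kottwitz1992, §10 Lemma 10.1 p. 404] [cite: Shimura1998, §5.1 Lemma 2 and Prop. 5 pp. 36–37] -/
theorem isTotallyReal_or_isCMField_of_norm_embedding_sq_eq {π : K} (hgen : ℚ⟮π⟯ = ⊤) {c : ℚ} (hc : 0 < c)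
    (h : ∀ φ : K →+* ℂ, ‖φ π‖ ^ 2 = c) : IsTotallyReal K ∨ IsCMField K := by
  obtain ⟨ρ, hρ, -⟩ := (exists_positiveInvolution_iff hgen hc).mpr h
  exact isTotallyReal_or_isCMField_of_trace_mul_nonneg ρ (trace_mul_nonneg_of_pos ρ hρ)

/-- **Totally real case**: if `K` is totally real and `|φ(π)|² = c` for an (equivalently every) embedding, then
`π² = c` (`φ(π)` is real, so `|φ(π)|² = φ(π²)`). [cite: Kottwitz1992, §10 Lemma 10.1 p. 404] -/
theorem sq_eq_of_isTotallyReal [IsTotallyReal K] {π : K} {c : ℚ} (h : ∀ φ : K →+* ℂ, ‖φ π‖ ^ 2 = c) :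
    π ^ 2 = c := by
  let φ : K →+* ℂ := Classical.choice inferInstance
  apply φ.injective
  have hreal : conj (φ π) = φ π := by
    rw [← conjugate_coe_eq]
    exact RingHom.congr_fun (isReal_iff.mp (IsTotallyReal.complexEmbedding_isReal φ)) π
  have hsq : φ π * conj (φ π) = (c : ℂ) := by
    rw [Complex.mul_conj, Complex.normSq_eq_norm_sq]; exact_mod_cast h φ
  rw [map_pow, map_ratCast, sq, ← hsq, hreal]

/-- **CM case, (1) ⇒ (2) with the positive involution = complex conjugation**: in a CM field, `π̄ π = c` gives
`|φ(π)|² = c` for every embedding. [cite: Kottwitz1992, §10 Lemma 10.1 p. 404] -/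
theorem norm_embedding_sq_eq_of_complexConj_mul_self_eq [IsCMField K] {π : K} {c : ℚ}
    (h : (IsCMField.complexConj K π : K) * π = c) (φ : K →+* ℂ) : ‖φ π‖ ^ 2 = c := by
  have h1 := congrArg φ h
  rw [map_mul, IsCMField.complexEmbedding_complexConj, map_ratCast, mul_comm, Complex.mul_conj,
    Complex.normSq_eq_norm_sq] at h1
  exact_mod_cast h1

/-- **CM case, (2) ⇒ (1)**: in a CM field, `|φ(π)|² = c` for every embedding gives `π̄ π = c` (no generation
hypothesis: complex conjugation is conjugation under every embedding). [cite: Kottwitz1992, §10 Lemma 10.1 p. 404] -/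
theorem complexConj_mul_self_eq_of_norm_embedding_sq_eq [IsCMField K] {π : K} {c : ℚ}
    (h : ∀ φ : K →+* ℂ, ‖φ π‖ ^ 2 = c) : (IsCMField.complexConj K π : K) * π = c := by
  let φ : K →+* ℂ := Classical.choice inferInstance
  apply φ.injective
  rw [map_mul, IsCMField.complexEmbedding_complexConj, map_ratCast, mul_comm, Complex.mul_conj,
    Complex.normSq_eq_norm_sq]
  exact_mod_cast h φ

/-- **Lemma 10.1 for a CM field, with its (unique) positive involution complex conjugation**: `π̄ π = c` iff
`|φ(π)|² = c` for every complex embedding `φ`. [cite: Kottwitz1992, §10 Lemma 10.1 p. 404] -/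
theorem complexConj_mul_self_eq_iff [IsCMField K] {π : K} {c : ℚ} :
    (IsCMField.complexConj K π : K) * π = c ↔ ∀ φ : K →+* ℂ, ‖φ π‖ ^ 2 = c :=
  ⟨norm_embedding_sq_eq_of_complexConj_mul_self_eq, complexConj_mul_self_eq_of_norm_embedding_sq_eq⟩

end Literature.NumberTheory.NumberFields.PositiveInvolutionCNumber
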